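/-
Origin: expansion seat `planner-pub-hodgecm-pv12-g4-0`, handover #2 2026-08-18T06:03:03Z (`HOME/pub-hodgecm-pv12-g4/lean/Pv12g4/FockGroupInvariants.lean`, md5 1708d474, 836 lines);
landed by the gen-6 packager in gate run 24 as `HodgeCM/PerL34/FockGroupInvariants.lean` (verbatim).
-/
/-
Origin: HOME/pub-hodgecm-pv12-g4/lean/Pv12g4/FockGroupInvariants.lean — session planner-pub-hodgecm-pv12-g4-0 (unit
pub-hodgecm-pv12-g4, DAG-node prover #12 gen 4, the Fock-model seat; successor of pv12 `ArchB`/`ArchBGen`/`FockKTypes`,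
pv12-g2 `ArchCFock(Smoke)`, pv12-g3 `ArchCFockAnalytic(Smoke)`/`ArchCKernelDictionary`).
Intended final place: `HodgeCM/PerL34/FockGroupInvariants.lean`.  Imports the LANDED `HodgeCM.PerL34.ArchB` (run 20) and
Mathlib only; asserts nothing.
-/
import Summits.HodgeConjecture.HodgeCM.PerL34.ArchB
import Mathlib.RingTheory.RootsOfUnity.Complex
import Mathlib.LinearAlgebra.UnitaryGroup
import Mathlib.Algebra.MvPolynomial.Monad
import Mathlib.Algebra.MvPolynomial.Funext
import Mathlib.Analysis.Complex.Basic

set_option autoImplicit false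

/-!
# N28 supplement — PerL v5 Lemma 4.1(b) at GROUP level: the three compact-group statements of ll. 499–509,
# kernel-proved, and their equivalence with the Lie-algebra typings of `HodgeCM.PerL34.ArchB`

NODE: LEMMAS.md §1 row N28 (= PerL v5 `lem:arch` (b), tex ll. 483–487, proof ll. 496–513; already CLOSED MODULO
the N26 dictionary by pv12's `ArchB` + `ArchBGen` + `FockKTypes`, gate runs 20–22).  This file adds nothing to the
list of inputs and removes one sentence from the dictionary prose.

THE POINT.  PerL's proof of (b) makes three statements about invariants / isotypic vectors of COMPACT GROUPS acting
on polynomial Fock models, VERBATIM (LEMMAS.md §5 N28):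

* (E) ll. 499–500: "the $\U(3)$-invariants of $\C[M_{3\times2}]$ (or of its conjugate) are the constants;
  $\phi^0_b:=1=\phi^0_{1,b}\otimes\phi^0_{2,b}$."
* (M) ll. 501–502: "model $\C[z_1,z_2,z_3,w_1,w_2,w_3]$ with $\U(3)$ acting by the standard representation on
  $z$ and its dual on $w$ (each vacuum twist trivial, as just explained), invariants $\C[P]$, $P=\sum_az_aw_a$".
* (I) ll. 506–509: "the $K_V$-type $\kappa=(1,1;-2)$ forces $|E|=0$ and row sums $(1,1)$, i.e.\ the $(1,1)$-weight
  space spanned by the $z_{1j}z_{2j'}$ … its $\U(2)_V$-invariants twisted by $\det$ (the $\kappa$-isotypic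
  vectors) form the line $\wedge^2V^+\otimes\wedge^2W=\C\det(z)$".

`ArchB` typed each of them INFINITESIMALLY — (E) `Fock.eq_C_of_eqTorus` (killed by the diagonal torus `𝔱 ⊂ 𝔲(3)`),
(M) `Fock.isU3Invariant_iff` (`𝔱`-weight `0` and killed by the root operators `E_{ab}` of `𝔤𝔩₃ = 𝔲(3)_ℂ`),
(I) `Fock.isKappaVector_iff` (weights `(1,1;0)` relative to the vacuum and killed by `E₊, E₋` of `𝔰𝔩₂(V⁺)`) — and
said so in its docstrings ("infinitesimally"); that the Lie-algebra typing IS PerL's group statement (the groups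
`U(3)`, `U(2)_V × U(1)_V` being connected and the representations polynomial) was left to the reader as part of the
untyped D5 dictionary (LEMMAS.md §3 D5 "local Fock models 𝓕_b = polynomial rings with 𝔲(p,q)-action, K-types").
THIS FILE types the three statements LITERALLY AT GROUP LEVEL — unitary matrices (`Matrix.unitaryGroup (Fin n) ℂ`,
Mathlib) acting on the SAME polynomial rings `Fock.EqModel`, `Fock.MixedModel`, `Fock.PlaneModel` by linear
substitution of the variables — and KERNEL-PROVES, with complete proofs and the standard axiom trio only:

* (E) `isU3FixedGrp_iff`       : `(∀ A ∈ U(3), A·f = f) ↔ ∃ x, f = C x`                (`A·z_{aj} = Σ_b A_{ab} z_{bj}`;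
                                 the conjugate model "(or of its conjugate)", `A` acting through `Ā`, has the same
                                 fixed space: `isU3FixedGrp_iff_conj`);
* (M) `isU3InvariantGrp_iff`   : `(∀ A ∈ U(3), (A,Ā)·f = f) ↔ f ∈ span_ℂ {P^k}`         (`z ↦ Az`, `w ↦ Āw`);
* (I) `isKappaVectorGrp_iff`   : `(∀ A ∈ U(2), ∀ |t| = 1, (A,t)·f = det A • f) ↔ ∃ a, f = a • det(z)`
                                 (`z_{aj} ↦ Σ_b A_{ab} z_{bj}`, `w_j ↦ t̄ w_j`; the vacuum character `(0,0;−2)` of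
                                 l. 506 factored out exactly as in `Fock.IsKappaVector` — INPUT N26, unchanged);
* and the three DICTIONARY EQUIVALENCES group ⟺ Lie algebra, now theorems rather than prose:
  `isU3FixedGrp_iff_eqTorus : IsU3FixedGrp f ↔ ∀ a, weightOp (eqTorWt a) f = 0`,
  `isU3InvariantGrp_iff_isU3Invariant : IsU3InvariantGrp f ↔ Fock.IsU3Invariant f`,
  `isKappaVectorGrp_iff_isKappaVector : IsKappaVectorGrp f ↔ Fock.IsKappaVector f`.

So BOTH readings of ll. 500–509 are kernel theorems and they coincide; the N28 residual is exactly as recorded in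
GAPS.md `### pv12/N28` / `### pv12g3-S4` minus the sentence "group `K`-types = Lie-algebra weights/roots": what is
still INPUT (node N26) / PRINT is only the identification of `(𝓕_b, ω_{W,b})|_{U(V_b) × T_b}` with these polynomial
models together with the vacuum characters [J. Adams, The theta correspondence over ℝ (2007) Prop. 6.6; A. Borel –
N. Wallach, Continuous cohomology … (2000) VIII §2 — locators in `ArchB`'s docstring; NOT restated or used here].
NOTHING is cited or asserted in this file: no PerL statement, no [Y1neg], no QW8, no 2001-programme claim; every
`theorem` below is proved.

METHOD (all elementary; only finitely many group elements are ever used).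
* §0 Diagonal substitutions `X_i ↦ s_i X_i` multiply `coeff_m` by `Π s_i^{m_i}` (`coeff_scale`); roots of unity
  `ζ_N = e^{2πi/N}` (`Complex.isPrimitiveRoot_exp`) as torus entries: `ζ_N^k = 1, k < N ⇒ k = 0` and
  `IsPrimitiveRoot.pow_inj`; diagonal matrices with unimodular entries are unitary (`diagonal_mem_unitaryGroup`).
* (E) the centre `ζ·1 ⊂ U(3)` multiplies a degree-`d` monomial by `ζ^d`; `ζ = ζ_{d+1}` kills every `d ≠ 0`.
* (I) the torus `diag(ζ,1), diag(1,ζ) ∈ U(2)_V` (acting by `det = ζ`) and `t = ζ̄ ∈ U(1)_V` force row sums `(1,1)`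
  and `|E| = 0` — literally PerL's "forces |E|=0 and row sums (1,1)" — whence `f = Σ c_{jj'} z_{0j} z_{1j'}` by
  `ArchB`'s `Fock.eq_sum_of_weights`; the Weyl element `(0 1; 1 0) ∈ U(2)_V` (acting by `det = −1`) gives
  `c_{j'j} = −c_{jj'}`, i.e. `f = c_{01}·det(z)`; conversely `(A,t)·det(z) = det A · det(z)` for every `A ∈ M₂(ℂ)`.
* (M) `P` is fixed by every pair `(A,B)` with `AᵀB = 1` (`mixedSubst_P`), in particular by `(A, Ā)`, `A` unitary;
  conversely the torus `diag(…,ζ,…)` (`z_a ↦ ζ z_a`, `w_a ↦ ζ̄ w_a`) forces balanced support `α = β` — PerL's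
  "invariants": weight `α − β = 0` — so `f = F(z₁w₁, z₂w₂, z₃w₃)` for the contraction `F ∈ ℂ[y₁,y₂,y₃]`
  (`diagSubst_contract`); the two RATIONAL ROTATIONS `R01, R12 ∈ SO(3) ⊂ U(3)` by the angle with `cos θ = 3/5`,
  evaluated at the points `z = (4,3,1), w = (a/4,b/3,c)` resp. `z = (1,4,3), w = (a,b/4,c/3)`, give
  `F(a,b,c) = F(0,a+b,c) = F(0,0,a+b+c)` for all `a b c : ℂ`, hence `F = H(y₁+y₂+y₃)` (`MvPolynomial.funext`, `ℂ`
  infinite) and `f = H(P) ∈ span {P^k}` (`Polynomial.aeval_eq_sum_range`).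
  (The conjugate model of l. 500 — `A` replaced by `Ā` — has the same fixed space, `Ā` ranging over `U(3)` with `A`.)

LABEL CENSUS of this file: KERNEL — every declaration (defs of the substitution actions + theorems); PRINT — none;
INPUT — none beyond `ArchB`'s standing N26 convention that the vacuum characters are factored out of the polynomial
actions; ASSERTED — nothing.  `#print axioms` of `isU3FixedGrp_iff`, `isU3FixedGrp_iff_eqTorus`,
`isKappaVectorGrp_iff`, `isKappaVectorGrp_iff_isKappaVector`, `isU3InvariantGrp_iff`,
`isU3InvariantGrp_iff_isU3Invariant`, `IsU3InvariantGrp.mem_span`, `mixedSubst_P_of_mem`, `rowSubst_detZ`, `R01_mem`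
= `[propext, Classical.choice, Quot.sound]` (scratch `Pv12g4/AxCheck.lean`, not for landing).

RELATION TO OTHER FOCK FILES (disjoint content): pv05-g3 `FockIrreducible` / `FockGL3` / `FockLowestWeight` and
pv14-g3 `P43_KTypesFock(Jplus)` concern the `U(2,1)` model `Fock.HarmModel = ℂ[z₁,z₂,w]` of `FockKTypes` (Howe
duality at Lie-algebra level; a `K = U(2)×U(1)` group `Representation` for no-embedding statements); this file
concerns the three N28 models of `ArchB` and the compact groups of PerL ll. 500–509.  Namespace
`HodgeCM.PerL34.Fock.GroupLevel` (new); no existing declaration is redefined or shadowed.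

PACKAGER: ONE NEW FILE, additive; imports the LANDED `HodgeCM.PerL34.ArchB` (run 20) and five Mathlib modules; no
`Pv*` import, nothing to rewrite; intended path `HodgeCM/PerL34/FockGroupInvariants.lean`.
-/

open MvPolynomial Finsupp
open scoped BigOperators ComplexConjugate

namespace HodgeCM
namespace PerL34
namespace Fock
namespace GroupLevel

/-! ## §0  Diagonal scaling substitutions and their coefficients -/

section Scaling

variable {σ : Type*}

/-- The diagonal substitution `X_i ↦ s_i · X_i`. -/
noncomputable def scale (s : σ → ℂ) : MvPolynomial σ ℂ →ₐ[ℂ] MvPolynomial σ ℂ :=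
  aeval fun i => C (s i) * X i

/-- (Ported verbatim from the HodgeCMPerL package; no docstring in the source.) -/
theorem scale_X (s : σ → ℂ) (i : σ) : scale s (X i) = C (s i) * X i := by
  rw [scale, aeval_X]

/-- The scaling factor of the monomial `m`: `Π_i s_i ^ m_i`. -/
noncomputable def scaleFactor (s : σ → ℂ) (m : σ →₀ ℕ) : ℂ := m.prod fun i e => s i ^ e

/-- (Ported verbatim from the HodgeCMPerL package; no docstring in the source.) -/
theorem scale_monomial (s : σ → ℂ) (m : σ →₀ ℕ) (c : ℂ) :
    scale s (monomial m c) = monomial m (c * scaleFactor s m) := by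
  classical
  rw [scale, aeval_eq_bind₁, bind₁_monomial]
  have : ∏ i ∈ m.support, (C (s i) * X i : MvPolynomial σ ℂ) ^ m i
      = C (scaleFactor s m) * ∏ i ∈ m.support, (X i : MvPolynomial σ ℂ) ^ m i := by
    rw [scaleFactor, Finsupp.prod, map_prod, ← Finset.prod_mul_distrib]
    refine Finset.prod_congr rfl fun i _ => ?_
    rw [mul_pow, map_pow]
  rw [this, ← mul_assoc, ← map_mul, monomial_eq, Finsupp.prod]

/-- Scaling is diagonal on monomials. -/
theorem coeff_scale (s : σ → ℂ) (f : MvPolynomial σ ℂ) (m : σ →₀ ℕ) :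
    coeff m (scale s f) = coeff m f * scaleFactor s m := by
  classical
  induction f using MvPolynomial.induction_on' with
  | monomial u a =>
      rw [scale_monomial, coeff_monomial, coeff_monomial]
      split_ifs with h
      · subst h; rfl
      · rw [zero_mul]
  | add p q hp hq => rw [map_add, coeff_add, coeff_add, hp, hq, add_mul]

/-- If `f` is fixed by the scaling `s` up to the scalar `c`, every monomial `m` of `f` has `scaleFactor s m = c`. -/
theorem scaleFactor_eq_of_scale_eq_smul {s : σ → ℂ} {f : MvPolynomial σ ℂ} {c : ℂ}
    (h : scale s f = c • f) {m : σ →₀ ℕ} (hm : m ∈ f.support) : scaleFactor s m = c := by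
  have hc : coeff m f ≠ 0 := MvPolynomial.mem_support_iff.mp hm
  have h1 := congrArg (coeff m) h
  rw [coeff_scale, coeff_smul, smul_eq_mul, mul_comm c] at h1
  exact mul_left_cancel₀ hc h1

/-- (Ported verbatim from the HodgeCMPerL package; no docstring in the source.) -/
theorem scaleFactor_eq_one_of_scale_eq {s : σ → ℂ} {f : MvPolynomial σ ℂ}
    (h : scale s f = f) {m : σ →₀ ℕ} (hm : m ∈ f.support) : scaleFactor s m = 1 :=
  scaleFactor_eq_of_scale_eq_smul (c := 1) (by rw [h, one_smul]) hm

end Scaling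

/-! ## §0'  Roots of unity used as torus elements -/

/-- `ζ_N = exp(2πi/N)`. -/
noncomputable def ζ (N : ℕ) : ℂ := Complex.exp (2 * Real.pi * Complex.I / N)

/-- (Ported verbatim from the HodgeCMPerL package; no docstring in the source.) -/
theorem ζ_prim (N : ℕ) (hN : N ≠ 0) : IsPrimitiveRoot (ζ N) N :=
  Complex.isPrimitiveRoot_exp N hN

/-- (Ported verbatim from the HodgeCMPerL package; no docstring in the source.) -/
theorem norm_ζ (N : ℕ) (hN : N ≠ 0) : ‖ζ N‖ = 1 := (ζ_prim N hN).norm'_eq_one hN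

/-- (Ported verbatim from the HodgeCMPerL package; no docstring in the source.) -/
theorem ζ_ne_zero (N : ℕ) (hN : N ≠ 0) : ζ N ≠ 0 := (ζ_prim N hN).ne_zero hN

/-- (Ported verbatim from the HodgeCMPerL package; no docstring in the source.) -/
theorem ζ_mul_conj (N : ℕ) (hN : N ≠ 0) : ζ N * conj (ζ N) = 1 := by
  rw [Complex.mul_conj', norm_ζ N hN]; norm_num

/-- (Ported verbatim from the HodgeCMPerL package; no docstring in the source.) -/
theorem conj_ζ (N : ℕ) (hN : N ≠ 0) : conj (ζ N) = (ζ N)⁻¹ :=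
  eq_inv_of_mul_eq_one_left (by rw [mul_comm]; exact ζ_mul_conj N hN)

/-- `ζ_N ^ k = 1` for a natural `k < N` forces `k = 0`. -/
theorem eq_zero_of_ζ_pow_eq_one {N k : ℕ} (hk : k < N) (h : ζ N ^ k = 1) : k = 0 := by
  have hN : N ≠ 0 := by omega
  have := (ζ_prim N hN).pow_inj hk (Nat.pos_of_ne_zero hN) (by rw [h, pow_zero])
  exact this

/-- `ζ_N ^ k = 1` for an integer `k` with `|k| < N` forces `k = 0`. -/
theorem eq_zero_of_ζ_zpow_eq_one {N : ℕ} {k : ℤ} (hk : k.natAbs < N) (h : ζ N ^ k = 1) : k = 0 := by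
  have hN : N ≠ 0 := by omega
  have hd : (N : ℤ) ∣ k := ((ζ_prim N hN).zpow_eq_one_iff_dvd k).mp h
  exact Int.eq_zero_of_dvd_of_natAbs_lt_natAbs hd (by simpa using hk)


/-! ## §0''  Product formulas for scaling factors; diagonal unitary matrices -/

section ScalingFormulas

variable {σ : Type*}

/-- (Ported verbatim from the HodgeCMPerL package; no docstring in the source.) -/
theorem scaleFactor_eq_prod [Fintype σ] (s : σ → ℂ) (m : σ →₀ ℕ) :
    scaleFactor s m = ∏ i, s i ^ m i := by
  rw [scaleFactor, Finsupp.prod_fintype]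
  intro i
  exact pow_zero _

/-- (Ported verbatim from the HodgeCMPerL package; no docstring in the source.) -/
theorem scaleFactor_const (x : ℂ) (m : σ →₀ ℕ) : scaleFactor (fun _ => x) m = x ^ m.degree := by
  rw [scaleFactor, Finsupp.prod, Finset.prod_pow_eq_pow_sum, Finsupp.degree_apply]

end ScalingFormulas

section Unitary

variable {n : Type*} [Fintype n] [DecidableEq n]

/-- A diagonal matrix with entries on the unit circle is unitary. -/
theorem diagonal_mem_unitaryGroup (d : n → ℂ) (hd : ∀ i, d i * conj (d i) = 1) :
    Matrix.diagonal d ∈ Matrix.unitaryGroup n ℂ := by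
  rw [Matrix.mem_unitaryGroup_iff, Matrix.star_eq_conjTranspose, Matrix.diagonal_conjTranspose,
    Matrix.diagonal_mul_diagonal, ← Matrix.diagonal_one]
  congr 1
  funext i
  exact hd i

end Unitary

/-! ## §1  (E) `b ∈ D₁₂` — PerL l. 500 verbatim: "the $\U(3)$-invariants of $\C[M_{3\times2}]$ (or of its
conjugate) are the constants" — at GROUP level -/

section EqualSign

/-- The substitution by which `A ∈ M₃(ℂ)` acts on `ℂ[M_{3×2}] = EqModel` through the row (= `U(3) = U(V_b)`) index:
`z_{aj} ↦ Σ_b A_{ab} z_{bj}`. -/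
noncomputable def eqSubstFun (A : Matrix (Fin 3) (Fin 3) ℂ) : EqVar → EqModel :=
  fun v => ∑ b : Fin 3, A v.1 b • X (b, v.2)

/-- `A · f` for `f ∈ ℂ[M_{3×2}]` (an algebra endomorphism; for the conjugate model replace `A` by `Ā` — the set of
fixed vectors of the whole group `U(3) = conj(U(3))` is the same). -/
noncomputable def eqSubst (A : Matrix (Fin 3) (Fin 3) ℂ) : EqModel →ₐ[ℂ] EqModel :=
  aeval (eqSubstFun A)

/-- (Ported verbatim from the HodgeCMPerL package; no docstring in the source.) -/
theorem eqSubst_X (A : Matrix (Fin 3) (Fin 3) ℂ) (v : EqVar) :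
    eqSubst A (X v) = ∑ b : Fin 3, A v.1 b • X (b, v.2) := by
  rw [eqSubst, aeval_X]; rfl

/-- **`U(3)`-fixed at group level**: `A · f = f` for every unitary `A`. -/
def IsU3FixedGrp (f : EqModel) : Prop :=
  ∀ A ∈ Matrix.unitaryGroup (Fin 3) ℂ, eqSubst A f = f

/-- (Ported verbatim from the HodgeCMPerL package; no docstring in the source.) -/
theorem eqSubst_diagonal (d : Fin 3 → ℂ) :
    eqSubst (Matrix.diagonal d) = scale (fun v : EqVar => d v.1) := by
  refine MvPolynomial.algHom_ext fun v => ?_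
  rw [scale_X, eqSubst_X]
  simp [Matrix.diagonal_apply, smul_eq_C_mul]

/-- (Ported verbatim from the HodgeCMPerL package; no docstring in the source.) -/
theorem coeff_eqSubst_scalar (x : ℂ) (f : EqModel) (m : EqVar →₀ ℕ) :
    coeff m (eqSubst (Matrix.diagonal fun _ => x) f) = coeff m f * x ^ m.degree := by
  rw [eqSubst_diagonal, coeff_scale]
  exact congrArg _ (scaleFactor_const x m)

/-- PerL l. 500 at group level: a `U(3)`-fixed polynomial on `M_{3×2}` is constant.  (Only the centre
`{ζ·1 : |ζ| = 1} ⊂ U(3)` is used: `ζ·1` multiplies a monomial of degree `d` by `ζ^d`, and `ζ = e^{2πi/(d+1)}` has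
`ζ^d ≠ 1` unless `d = 0`.) -/
theorem IsU3FixedGrp.eq_C {f : EqModel} (h : IsU3FixedGrp f) : f = C (coeff 0 f) := by
  classical
  refine eq_C_of_support_subset_zero fun m hm => ?_
  by_contra hm0
  have hdeg : m.degree ≠ 0 := fun h0 => hm0 ((Finsupp.degree_eq_zero_iff m).mp h0)
  have hN : m.degree + 1 ≠ 0 := by omega
  have hmem : Matrix.diagonal (fun _ : Fin 3 => ζ (m.degree + 1)) ∈ Matrix.unitaryGroup (Fin 3) ℂ :=
    diagonal_mem_unitaryGroup _ fun _ => ζ_mul_conj _ hN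
  have h1 := congrArg (coeff m) (h _ hmem)
  rw [coeff_eqSubst_scalar] at h1
  have hc : coeff m f ≠ 0 := MvPolynomial.mem_support_iff.mp hm
  have hpow : ζ (m.degree + 1) ^ m.degree = 1 :=
    mul_left_cancel₀ hc (h1.trans (mul_one _).symm)
  exact hdeg (eq_zero_of_ζ_pow_eq_one (by omega) hpow)

/-- (Ported verbatim from the HodgeCMPerL package; no docstring in the source.) -/
theorem isU3FixedGrp_C (x : ℂ) : IsU3FixedGrp (C x) := by
  intro A _
  rw [eqSubst, aeval_C]; rfl

/-- **(E) at group level.** `f ∈ ℂ[M_{3×2}]` is fixed by `U(3)` iff it is a constant. -/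
theorem isU3FixedGrp_iff (f : EqModel) : IsU3FixedGrp f ↔ ∃ x : ℂ, f = C x :=
  ⟨fun h => ⟨coeff 0 f, h.eq_C⟩, by rintro ⟨x, rfl⟩; exact isU3FixedGrp_C x⟩

/-- Group level ⟺ pv12's Lie-algebra level (`ArchB`: killed by the diagonal torus `𝔱 ⊂ 𝔲(3)`,
`Fock.eq_C_of_eqTorus`): the two typings of "`U(3)`-invariant" in `ℂ[M_{3×2}]` agree. -/
theorem isU3FixedGrp_iff_eqTorus (f : EqModel) :
    IsU3FixedGrp f ↔ ∀ a : Fin 3, weightOp (eqTorWt a) f = 0 := by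
  constructor
  · intro h a
    rw [h.eq_C, MvPolynomial.C_eq_smul_one, map_smul, N28_kernel.2.2.2.2.2.2.2.2.1, smul_zero]
  · intro h
    rw [eq_C_of_eqTorus f h]
    exact isU3FixedGrp_C _

/-- `A ∈ U(n) ⇒ Ā ∈ U(n)`. -/
theorem map_conj_mem_unitaryGroup {n : Type*} [Fintype n] [DecidableEq n] {A : Matrix n n ℂ}
    (hA : A ∈ Matrix.unitaryGroup n ℂ) : A.map (starRingEnd ℂ) ∈ Matrix.unitaryGroup n ℂ := by
  rw [Matrix.mem_unitaryGroup_iff] at hA ⊢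
  have h1 : star (A.map (starRingEnd ℂ)) = A.transpose := by
    ext i j; simp
  have h2 : A.map (starRingEnd ℂ) = (star A).transpose := by
    ext i j; simp
  rw [h1, h2, ← Matrix.transpose_mul, hA, Matrix.transpose_one]

/-- The parenthetical "(or of its conjugate)" of l. 500: in the conjugate model `A ∈ U(3)` acts through `Ā`; since
`Ā` ranges over `U(3)` together with `A`, the fixed vectors are the same (hence again the constants). -/
theorem isU3FixedGrp_iff_conj (f : EqModel) :
    IsU3FixedGrp f ↔ ∀ A ∈ Matrix.unitaryGroup (Fin 3) ℂ, eqSubst (A.map (starRingEnd ℂ)) f = f := by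
  constructor
  · exact fun h A hA => h _ (map_conj_mem_unitaryGroup hA)
  · intro h A hA
    have e : (A.map (starRingEnd ℂ)).map (starRingEnd ℂ) = A := by
      ext i j; simp
    have := h _ (map_conj_mem_unitaryGroup hA)
    rwa [e] at this

end EqualSign

/-! ## §3  (I) `b = ι₁` — PerL ll. 506–509 verbatim: "the $K_V$-type $\kappa=(1,1;-2)$ forces $|E|=0$ and row sums
$(1,1)$ … its $\U(2)_V$-invariants twisted by $\det$ (the $\kappa$-isotypic vectors) form the line
$\wedge^2V^+\otimes\wedge^2W=\C\det(z)$" — at GROUP level -/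

section Plane

/-- The substitution by which `(A, t) ∈ M₂(ℂ) × ℂ` (for `(A,t) ∈ K_V = U(2)_V × U(1)_V`) acts on the plane model
`ℂ[z_{aj}, w_j]`: `z_{aj} ↦ Σ_b A_{ab} z_{bj}` (`U(2)_V` on the row index by the standard representation `V⁺`),
`w_j ↦ t̄ w_j` (`U(1)_V`-weight `−1` per `w`, PerL l. 506 "`K_V`-weight of `z^A w^E` equal to (row sums of `A`;
`−2−|E|`)", the vacuum part `(0,0;−2)` being a scalar character — INPUT from node N26, factored out exactly as in
pv12's infinitesimal typing `Fock.IsKappaVector`). -/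
noncomputable def rowSubstFun (A : Matrix (Fin 2) (Fin 2) ℂ) (t : ℂ) : PlaneVar → PlaneModel
  | Sum.inl (a, j) => ∑ b : Fin 2, A a b • z b j
  | Sum.inr j => conj t • w j

/-- (Ported verbatim from the HodgeCMPerL package; no docstring in the source.) -/
@[simp] theorem rowSubstFun_inl (A : Matrix (Fin 2) (Fin 2) ℂ) (t : ℂ) (a j : Fin 2) :
    rowSubstFun A t (Sum.inl (a, j)) = ∑ b : Fin 2, A a b • z b j := rfl

/-- (Ported verbatim from the HodgeCMPerL package; no docstring in the source.) -/
@[simp] theorem rowSubstFun_inr (A : Matrix (Fin 2) (Fin 2) ℂ) (t : ℂ) (j : Fin 2) :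
    rowSubstFun A t (Sum.inr j) = conj t • w j := rfl

/-- `(A, t) · f`. -/
noncomputable def rowSubst (A : Matrix (Fin 2) (Fin 2) ℂ) (t : ℂ) : PlaneModel →ₐ[ℂ] PlaneModel :=
  aeval (rowSubstFun A t)

/-- (Ported verbatim from the HodgeCMPerL package; no docstring in the source.) -/
theorem rowSubst_z (A : Matrix (Fin 2) (Fin 2) ℂ) (t : ℂ) (a j : Fin 2) :
    rowSubst A t (z a j) = ∑ b : Fin 2, A a b • z b j := by
  rw [rowSubst, z, aeval_X, rowSubstFun_inl]

/-- (Ported verbatim from the HodgeCMPerL package; no docstring in the source.) -/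
theorem rowSubst_w (A : Matrix (Fin 2) (Fin 2) ℂ) (t : ℂ) (j : Fin 2) :
    rowSubst A t (w j) = conj t • w j := by
  rw [rowSubst, w, aeval_X, rowSubstFun_inr, w]

/-- **`κ`-isotypic at group level** (PerL ll. 506–509): `(A,t) · f = det(A) · f` for all `(A,t) ∈ U(2)_V × U(1)_V`
— i.e. `U(1)_V` acts through the vacuum character alone (`|E| = 0`) and `U(2)_V` by `det` ("its
`U(2)_V`-invariants twisted by `det` (the `κ`-isotypic vectors)"). -/
def IsKappaVectorGrp (f : PlaneModel) : Prop :=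
  ∀ A ∈ Matrix.unitaryGroup (Fin 2) ℂ, ∀ t : ℂ, ‖t‖ = 1 → rowSubst A t f = A.det • f

/-- `det(z)` transforms by `det(A)` under every `A ∈ M₂(ℂ)` (and is untouched by `t`). -/
theorem rowSubst_detZ (A : Matrix (Fin 2) (Fin 2) ℂ) (t : ℂ) : rowSubst A t detZ = A.det • detZ := by
  simp only [detZ, map_sub, map_mul, rowSubst_z, Fin.sum_univ_two, Matrix.det_fin_two, smul_eq_C_mul, map_sub,
    map_mul]
  ring

/-- (Ported verbatim from the HodgeCMPerL package; no docstring in the source.) -/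
theorem isKappaVectorGrp_smul_detZ (a : ℂ) : IsKappaVectorGrp (a • detZ) := by
  intro A _ t _
  rw [map_smul, rowSubst_detZ, smul_comm]


-- port_pkg: scope closed for this part
end Plane
end GroupLevel
end Fock
end PerL34
end HodgeCM
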